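import Mathlib
import HarnessLib
import Literature.Analysis.FluidPDE.ParabolicComparison
import Literature.Analysis.FluidPDE.SwirlMaximumPrinciple

/-!
# Route `PoloidalWindowDoor`, crux `PoloidalWindowRigidity` (K2, stmt-NavierStokesRegularity-19708), line
# `slicesharp-screw` — stub L4a `stub_wholeSpaceComparison`: whole-space comparison in the linear-growth class

Cell ns-regularity-ideate, seat ns-poloidal-K2-p3 (stub-worker; registered stub of the K2 lead's skeleton
`slicesharp-screw` rev 4, sha16 04533a4f459e0895, signature VERBATIM; lands `--supports` the crux).

**Statement (L4a).**  On `ℝ³ × [t₀, t₁]`: a classical solution `w` of `∂ₜw + (b·∇)w − Δw = 0` (jointly continuous,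
`C²` slices, classical time derivative `wt`) with drift bounded by the constant `A` and of LINEAR GROWTH
`|w| ≤ M(1 + ‖x‖)`, and a classical nonnegative super-barrier `Ψ` (`Ψₜ ≥ ΔΨ + A‖∇Ψ‖`) dominating `|w|` at `t₀`,
satisfy `|w| ≤ Ψ` on the whole slab.

**Proof** (Lieberman 1996, Ch. II, Lemma 2.1/2.3 in the abstract form of the tree's `weak_max_principle`, with the
quadratic barrier of the tree's swirl maximum principle `SwirlMaximumPrinciple`): for a sign `σ = ±1`, `ε > 0` and
`β = A + 7`, the function `W = σw − Ψ − ε e^{β(t−t₀)}(1 + ‖x‖²)` satisfies the sub-solution implication on every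
ball — at a point with `∇W = 0`, `ΔW ≤ 0` one has `σ∇w = ∇Ψ + 2εe^{β(t−t₀)}⟪x,·⟫`, `σΔw ≤ ΔΨ + 6εe^{β(t−t₀)}`, so the
equation gives `σwₜ = σΔw − σ∇w·b ≤ ΔΨ + A‖∇Ψ‖ + εe^{β(t−t₀)}(6 + 2A‖x‖) ≤ Ψₜ + βεe^{β(t−t₀)}(1 + ‖x‖²)`, i.e.
`Wₜ ≤ 0` — it is `≤ 0` at `t = t₀` (`|w(t₀)| ≤ Ψ(t₀)`) and on the sphere `‖x‖ = R` once `ε(1 + R²) ≥ M(1 + R)`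
(linear growth against a quadratic barrier), hence `W ≤ 0` on `[t₀, t₁] × B̄(0, R)` for all large `R`; then
`ε → 0`.  The drift need not be continuous and no Tikhonov (Gaussian) correction is needed in the linear-growth
class.

WHAT THIS IS NOT: not a claim about Navier–Stokes regularity — a registered support stub (a linear parabolic
comparison lemma) of a door route's crux (bears_on LADDER-NS N0, rung N0-LocalTubeDoorPoloidal).
-/

noncomputable section

-- the summit and its single sub-problem share the name (CONVENTIONS §1), as in every Theorems file
set_option linter.dupNamespace false

namespace Summit.NavierStokesRegularity.NavierStokesRegularity.Theorems.PoloidalWindowDoorPoloidalWindowRigidityWholeSpaceComparison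

open MeasureTheory Set Function Filter Topology TopologicalSpace Metric InnerProductSpace
open scoped RealInnerProductSpace InnerProductSpace Laplacian ContDiff
open Literature.Analysis Literature.Analysis.FluidPDE

/-! ### The quadratic barrier `c (1 + ‖x‖²)` -/

/-- Gradient of the quadratic barrier: `D(c(1 + ‖·‖²))(x) = c · 2⟪x, ·⟫`. -/
theorem hasFDerivAt_quadBarrier (c : ℝ) (x : EuclideanSpace ℝ (Fin 3)) :
    HasFDerivAt (fun y : EuclideanSpace ℝ (Fin 3) => c * (1 + ‖y‖ ^ 2))
      (c • ((2 : ℕ) • (innerSL ℝ x : EuclideanSpace ℝ (Fin 3) →L[ℝ] ℝ))) x := by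
  have h := hasFDerivAt_barrier 0 c x
  simp only [zero_add] at h
  exact h

/-- The quadratic barrier is smooth. -/
theorem contDiff_quadBarrier (c : ℝ) {n : WithTop ℕ∞} :
    ContDiff ℝ n (fun y : EuclideanSpace ℝ (Fin 3) => c * (1 + ‖y‖ ^ 2)) :=
  contDiff_const.mul (contDiff_const.add (contDiff_norm_sq ℝ))

/-- Laplacian of the quadratic barrier on `ℝ³`: `Δ(c(1 + ‖·‖²)) = 6c`. -/
theorem laplacian_quadBarrier (c : ℝ) (x : EuclideanSpace ℝ (Fin 3)) :
    (Δ (fun y : EuclideanSpace ℝ (Fin 3) => (c * (1 + ‖y‖ ^ 2) : ℝ))) x = 6 * c := by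
  have h := laplacian_barrier 0 c x
  simp only [zero_add] at h
  exact h

/-! ### One-sided comparison on large balls -/

/-- **One-sided comparison** (the heart of L4a): under the hypotheses of `stub_wholeSpaceComparison` (only the
ones the maximum principle uses), for a sign `σ = ±1`: `σ w ≤ Ψ` on `[t₀, t₁] × ℝ³`. -/
theorem sign_mul_le_of_superBarrier {b : ℝ → EuclideanSpace ℝ (Fin 3) → EuclideanSpace ℝ (Fin 3)} {A M : ℝ}
    {w Ψ Ψt wt : ℝ → EuclideanSpace ℝ (Fin 3) → ℝ} {t₀ t₁ : ℝ} (ht01 : t₀ < t₁)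
    (hbA : ∀ t ∈ Icc t₀ t₁, ∀ x, ‖b t x‖ ≤ A)
    (hw_c : ContinuousOn (uncurry w) (Icc t₀ t₁ ×ˢ univ))
    (hw2 : ∀ t ∈ Icc t₀ t₁, ContDiff ℝ 2 (w t))
    (hwt : ∀ x, ∀ t ∈ Icc t₀ t₁, HasDerivAt (fun τ => w τ x) (wt t x) t)
    (hlaw : ∀ t ∈ Icc t₀ t₁, ∀ x, wt t x + fderiv ℝ (w t) x (b t x) - (Δ (w t)) x = 0)
    (hgrowth : ∀ t ∈ Icc t₀ t₁, ∀ x, |w t x| ≤ M * (1 + ‖x‖))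
    (hΨ2 : ∀ t, ContDiff ℝ 2 (Ψ t))
    (hΨ_c : ContinuousOn (uncurry Ψ) (Icc t₀ t₁ ×ˢ univ))
    (hΨt : ∀ x, ∀ t ∈ Icc t₀ t₁, HasDerivAt (fun τ => Ψ τ x) (Ψt t x) t)
    (hΨineq : ∀ t ∈ Icc t₀ t₁, ∀ x, (Δ (Ψ t)) x + A * ‖fderiv ℝ (Ψ t) x‖ ≤ Ψt t x)
    (hΨ0 : ∀ t ∈ Icc t₀ t₁, ∀ x, 0 ≤ Ψ t x)
    (hinit : ∀ x, |w t₀ x| ≤ Ψ t₀ x) {σ : ℝ} (hσ : σ = 1 ∨ σ = -1) :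
    ∀ t ∈ Icc t₀ t₁, ∀ x, σ * w t x ≤ Ψ t x := by
  have ht00 : t₀ ∈ Icc t₀ t₁ := ⟨le_rfl, ht01.le⟩
  have hA0 : 0 ≤ A := (norm_nonneg _).trans (hbA t₀ ht00 0)
  have hM0 : 0 ≤ M := by
    have h := hgrowth t₀ ht00 0
    rw [norm_zero, add_zero, mul_one] at h
    exact (abs_nonneg _).trans h
  have hσabs : ∀ a : ℝ, σ * a ≤ |a| := fun a => by
    rcases hσ with h | h
    · rw [h, one_mul]; exact le_abs_self a
    · rw [h, neg_one_mul]; exact neg_le_abs a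
  -- the rate of the barrier
  set β : ℝ := A + 7 with hβ
  have hβ0 : 0 ≤ β := by rw [hβ]; positivity
  -- the claim for every `ε > 0`, on every large ball
  suffices key : ∀ ε : ℝ, 0 < ε → ∀ R : ℝ, 1 ≤ R → 2 * M / ε ≤ R →
      ∀ t ∈ Icc t₀ t₁, ∀ x ∈ closedBall (0 : EuclideanSpace ℝ (Fin 3)) R,
        σ * w t x - Ψ t x - ε * Real.exp (β * (t - t₀)) * (1 + ‖x‖ ^ 2) ≤ 0 by
    intro t ht x
    refine le_of_forall_pos_le_add fun η hη => ?_
    set C : ℝ := Real.exp (β * (t - t₀)) * (1 + ‖x‖ ^ 2) with hC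
    have hCpos : 0 < C := by positivity
    set R : ℝ := max (max 1 (2 * M / (η / C))) ‖x‖ with hR
    have h := key (η / C) (div_pos hη hCpos) R ((le_max_left _ _).trans (le_max_left _ _))
      ((le_max_right _ _).trans (le_max_left _ _)) t ht x (mem_closedBall_zero_iff.2 (le_max_right _ _))
    have e : η / C * Real.exp (β * (t - t₀)) * (1 + ‖x‖ ^ 2) = η := by
      rw [hC]; field_simp
    rw [e] at h
    linarith
  intro ε hε R hR1 hR
  -- the comparison function and its time derivative
  set W : ℝ → EuclideanSpace ℝ (Fin 3) → ℝ := fun t x =>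
    σ * w t x - Ψ t x - ε * Real.exp (β * (t - t₀)) * (1 + ‖x‖ ^ 2) with hW
  set Wt : ℝ → EuclideanSpace ℝ (Fin 3) → ℝ := fun t x =>
    σ * wt t x - Ψt t x - β * (ε * Real.exp (β * (t - t₀)) * (1 + ‖x‖ ^ 2)) with hWt
  set K : Set (EuclideanSpace ℝ (Fin 3)) := closedBall 0 R with hK
  set U : Set (EuclideanSpace ℝ (Fin 3)) := ball 0 R with hU
  have hKc : IsCompact K := isCompact_closedBall _ _
  have hUo : IsOpen U := isOpen_ball
  have hUK : U ⊆ K := ball_subset_closedBall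
  -- (a) joint continuity
  have hc : ContinuousOn (uncurry W) (Icc t₀ t₁ ×ˢ K) := by
    have hwc : ContinuousOn (uncurry w) (Icc t₀ t₁ ×ˢ K) := hw_c.mono (prod_mono Subset.rfl (subset_univ _))
    have hΨc : ContinuousOn (uncurry Ψ) (Icc t₀ t₁ ×ˢ K) := hΨ_c.mono (prod_mono Subset.rfl (subset_univ _))
    have h2 : Continuous fun p : ℝ × EuclideanSpace ℝ (Fin 3) =>
        ε * Real.exp (β * (p.1 - t₀)) * (1 + ‖p.2‖ ^ 2) := by fun_prop
    refine ((((continuousOn_const (c := σ)).mul hwc).sub hΨc).sub h2.continuousOn).congr fun p _ => ?_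
    simp only [hW, uncurry, Pi.sub_apply, Pi.mul_apply]
  -- (b) smooth slices
  have h2 : ∀ t ∈ Ioc t₀ t₁, ContDiff ℝ 2 (W t) := fun t ht =>
    ((contDiff_const.mul (hw2 t ⟨ht.1.le, ht.2⟩)).sub (hΨ2 t)).sub
      (contDiff_quadBarrier (ε * Real.exp (β * (t - t₀))))
  -- (c) the time derivative
  have hWt' : ∀ t ∈ Ioc t₀ t₁, ∀ x ∈ U, HasDerivWithinAt (fun s => W s x) (Wt t x) (Icc t₀ t) t := by
    intro t ht x _
    have htI : t ∈ Icc t₀ t₁ := ⟨ht.1.le, ht.2⟩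
    have hexp : HasDerivAt (fun s => ε * Real.exp (β * (s - t₀)) * (1 + ‖x‖ ^ 2))
        (ε * (Real.exp (β * (t - t₀)) * β) * (1 + ‖x‖ ^ 2)) t := by
      have h1 : HasDerivAt (fun s => Real.exp (β * (s - t₀))) (Real.exp (β * (t - t₀)) * β) t := by
        have := (((hasDerivAt_id t).sub_const t₀).const_mul β).exp
        simpa using this
      exact (h1.const_mul ε).mul_const (1 + ‖x‖ ^ 2)
    have h := (((hwt x t htI).const_mul σ).sub (hΨt x t htI)).sub hexp
    refine (h.hasDerivWithinAt (s := Icc t₀ t)).congr_deriv ?_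
    simp only [hWt]; ring
  -- (d) the sub-solution implication, from the equation and the barrier inequality
  have hsub : ∀ t ∈ Ioc t₀ t₁, ∀ x ∈ U, fderiv ℝ (W t) x = 0 → (Δ (W t)) x ≤ 0 → Wt t x ≤ 0 := by
    intro t ht x _ hgrad hlap
    have htI : t ∈ Icc t₀ t₁ := ⟨ht.1.le, ht.2⟩
    set c : ℝ := ε * Real.exp (β * (t - t₀)) with hcdef
    have hc0 : 0 < c := by positivity
    -- derivatives of the three parts
    have hwd : DifferentiableAt ℝ (w t) x := ((hw2 t htI).differentiable two_ne_zero) x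
    have hΨd : DifferentiableAt ℝ (Ψ t) x := ((hΨ2 t).differentiable two_ne_zero) x
    have hB := hasFDerivAt_quadBarrier c x
    have hWderiv : HasFDerivAt (W t) (σ • fderiv ℝ (w t) x - fderiv ℝ (Ψ t) x -
        c • ((2 : ℕ) • (innerSL ℝ x : EuclideanSpace ℝ (Fin 3) →L[ℝ] ℝ))) x := by
      have h := ((hwd.hasFDerivAt.const_mul σ).sub hΨd.hasFDerivAt).sub hB
      simp only [hW, hcdef]
      exact h
    have hDeq : σ • fderiv ℝ (w t) x = fderiv ℝ (Ψ t) x +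
        c • ((2 : ℕ) • (innerSL ℝ x : EuclideanSpace ℝ (Fin 3) →L[ℝ] ℝ)) := by
      have := hWderiv.fderiv
      rw [hgrad] at this
      have h1 := sub_eq_zero.1 this.symm
      rw [sub_eq_iff_eq_add] at h1
      rw [h1]; abel
    have hDapply : ∀ a : EuclideanSpace ℝ (Fin 3),
        σ * fderiv ℝ (w t) x a = fderiv ℝ (Ψ t) x a + c * (2 * ⟪x, a⟫_ℝ) := fun a => by
      have := congrArg (fun L : EuclideanSpace ℝ (Fin 3) →L[ℝ] ℝ => L a) hDeq
      simpa [innerSL_apply_apply, nsmul_eq_mul] using this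
    -- Laplacians
    have hΔeq : (Δ (W t)) x = σ * (Δ (w t)) x - (Δ (Ψ t)) x - 6 * c := by
      have h1 : ContDiffAt ℝ 2 (fun y => σ * w t y) x := (contDiff_const.mul (hw2 t htI)).contDiffAt
      have h1' : ContDiffAt ℝ 2 (fun y => σ * w t y - Ψ t y) x := h1.sub (hΨ2 t).contDiffAt
      have h2' : ContDiffAt ℝ 2 (fun y : EuclideanSpace ℝ (Fin 3) => (c * (1 + ‖y‖ ^ 2) : ℝ)) x :=
        (contDiff_quadBarrier c).contDiffAt
      have h3 : (Δ (fun y => σ * w t y)) x = σ * (Δ (w t)) x := by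
        have : (fun y => σ * w t y) = σ • w t := by funext y; simp [smul_eq_mul]
        rw [this, laplacian_smul σ ((hw2 t htI).contDiffAt), smul_eq_mul]
      have h4 : (Δ (fun y => σ * w t y - Ψ t y)) x = σ * (Δ (w t)) x - (Δ (Ψ t)) x := by
        have e : (fun y => σ * w t y - Ψ t y) = (fun y => σ * w t y) - Ψ t := by funext y; simp
        rw [e, h1.laplacian_sub (hΨ2 t).contDiffAt, h3]
      have hfun : W t = (fun y => σ * w t y - Ψ t y) -
          fun y : EuclideanSpace ℝ (Fin 3) => (c * (1 + ‖y‖ ^ 2) : ℝ) := by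
        funext y; simp only [hW, hcdef, Pi.sub_apply]
      rw [hfun, h1'.laplacian_sub h2', h4, laplacian_quadBarrier]
    have hΔ : σ * (Δ (w t)) x ≤ (Δ (Ψ t)) x + 6 * c := by rw [hΔeq] at hlap; linarith
    -- the equation for `σ w`
    have hlaw' : σ * wt t x = σ * (Δ (w t)) x - σ * fderiv ℝ (w t) x (b t x) := by
      have h := hlaw t htI x; linear_combination σ * h
    -- drift terms
    have hb := hbA t htI x
    have hdrift1 : -(fderiv ℝ (Ψ t) x (b t x)) ≤ A * ‖fderiv ℝ (Ψ t) x‖ := by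
      have h1 : |fderiv ℝ (Ψ t) x (b t x)| ≤ ‖fderiv ℝ (Ψ t) x‖ * ‖b t x‖ := by
        rw [← Real.norm_eq_abs]; exact ContinuousLinearMap.le_opNorm _ _
      have h2 : ‖fderiv ℝ (Ψ t) x‖ * ‖b t x‖ ≤ ‖fderiv ℝ (Ψ t) x‖ * A :=
        mul_le_mul_of_nonneg_left hb (norm_nonneg _)
      have h3 := (abs_le.1 (h1.trans h2)).1
      linarith
    have hdrift2 : -(c * (2 * ⟪x, b t x⟫_ℝ)) ≤ c * (2 * (‖x‖ * A)) := by
      have h1 : |⟪x, b t x⟫_ℝ| ≤ ‖x‖ * ‖b t x‖ := abs_real_inner_le_norm _ _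
      have h2 : ‖x‖ * ‖b t x‖ ≤ ‖x‖ * A := mul_le_mul_of_nonneg_left hb (norm_nonneg _)
      have h3 := (abs_le.1 (h1.trans h2)).1
      nlinarith
    -- `σ wₜ ≤ Ψₜ + c (6 + 2A‖x‖)`
    have hσwt : σ * wt t x ≤ Ψt t x + (6 * c + c * (2 * (‖x‖ * A))) := by
      rw [hlaw', hDapply (b t x)]
      have := hΨineq t htI x
      linarith
    -- conclude with `β = A + 7`: `6c + 2cA‖x‖ ≤ β c (1 + ‖x‖²)`
    have hx2 : 2 * (‖x‖ * A) ≤ A * (1 + ‖x‖ ^ 2) := by nlinarith [sq_nonneg (‖x‖ - 1), norm_nonneg x]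
    have hkey : 6 * c + c * (2 * (‖x‖ * A)) ≤ β * (c * (1 + ‖x‖ ^ 2)) := by
      have h1 : c * (2 * (‖x‖ * A)) ≤ c * (A * (1 + ‖x‖ ^ 2)) := mul_le_mul_of_nonneg_left hx2 hc0.le
      have h2 : 6 * c ≤ 7 * (c * (1 + ‖x‖ ^ 2)) := by nlinarith [sq_nonneg ‖x‖]
      rw [hβ]; nlinarith
    have e3 : Wt t x = σ * wt t x - Ψt t x - β * (c * (1 + ‖x‖ ^ 2)) := by simp only [hWt, hcdef]
    rw [e3]
    linarith
  -- (e) the parabolic boundary: `t = t₀`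
  have hbot : ∀ x ∈ K, W t₀ x ≤ 0 := by
    intro x _
    simp only [hW, sub_self, mul_zero, Real.exp_zero, mul_one]
    have h1 := hσabs (w t₀ x)
    have h2 := hinit x
    have h3 : 0 ≤ ε * (1 + ‖x‖ ^ 2) := by positivity
    linarith
  -- (f) the parabolic boundary: the sphere `‖x‖ = R`
  have hlat : ∀ t ∈ Icc t₀ t₁, ∀ x ∈ K \ U, W t x ≤ 0 := by
    intro t ht x hx
    have hexp1 : 1 ≤ Real.exp (β * (t - t₀)) := Real.one_le_exp (mul_nonneg hβ0 (by linarith [ht.1]))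
    have hH : ε * (1 + ‖x‖ ^ 2) ≤ ε * Real.exp (β * (t - t₀)) * (1 + ‖x‖ ^ 2) := by
      have : ε * (1 + ‖x‖ ^ 2) * 1 ≤ ε * (1 + ‖x‖ ^ 2) * Real.exp (β * (t - t₀)) :=
        mul_le_mul_of_nonneg_left hexp1 (by positivity)
      linarith
    have hxK : ‖x‖ ≤ R := mem_closedBall_zero_iff.1 hx.1
    have hxR : ‖x‖ = R := by
      have hnot : x ∉ ball (0 : EuclideanSpace ℝ (Fin 3)) R := hx.2
      have : R ≤ ‖x‖ := by simpa using hnot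
      exact le_antisymm hxK this
    have h1 : σ * w t x ≤ M * (1 + R) := (hσabs _).trans (hxR ▸ hgrowth t ht x)
    have h2 : M * (1 + R) ≤ ε * (1 + ‖x‖ ^ 2) := by
      rw [hxR]
      have : 2 * M ≤ ε * R := by rw [div_le_iff₀ hε] at hR; linarith
      nlinarith
    have h3 := hΨ0 t ht x
    simp only [hW]
    linarith
  have hmain := weak_max_principle hKc hUo hUK hc h2 hWt' hsub hbot hlat
  intro t ht x hx
  have := hmain t ht x hx
  simpa only [hW] using this

/-! ### The registered stub -/

/-- **STUB L4a `stub_wholeSpaceComparison` (registered signature verbatim, skeleton `slicesharp-screw` rev 4):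
whole-space comparison in the Tikhonov / linear-growth class.**  On `ℝ³ × [t₀, t₁]`, a classical solution `w` of
`∂ₜw + (b·∇)w − Δw = 0` with `‖b‖ ≤ A` and `|w| ≤ M(1 + ‖x‖)` and a classical nonnegative super-barrier `Ψ` with
`ΔΨ + A‖∇Ψ‖ ≤ Ψₜ` and `|w(t₀)| ≤ Ψ(t₀)` satisfy `|w| ≤ Ψ` on the slab (`sign_mul_le_of_superBarrier` for both signs;
the continuity-in-time hypotheses on `∇w`, `Δw`, `wt`, `∇Ψ`, `ΔΨ`, `Ψt` and the continuity of `b` are not needed). -/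
theorem stub_wholeSpaceComparison :
    ∀ (b : ℝ → EuclideanSpace ℝ (Fin 3) → EuclideanSpace ℝ (Fin 3)) (A M : ℝ)
      (w Ψ Ψt : ℝ → EuclideanSpace ℝ (Fin 3) → ℝ) (t₀ t₁ : ℝ), t₀ < t₁ →
      ContinuousOn (Function.uncurry b) (Set.Icc t₀ t₁ ×ˢ Set.univ) →
      (∀ t ∈ Set.Icc t₀ t₁, ∀ x, ‖b t x‖ ≤ A) →
      ∀ (wt : ℝ → EuclideanSpace ℝ (Fin 3) → ℝ),
      ContinuousOn (Function.uncurry w) (Set.Icc t₀ t₁ ×ˢ Set.univ) →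
      (∀ t ∈ Set.Icc t₀ t₁, ContDiff ℝ 2 (w t)) →
      (∀ x, ContinuousOn (fun τ => fderiv ℝ (w τ) x) (Set.Icc t₀ t₁)) →
      (∀ x, ContinuousOn (fun τ => (Δ (w τ)) x) (Set.Icc t₀ t₁)) →
      (∀ x, ∀ t ∈ Set.Icc t₀ t₁, HasDerivAt (fun τ => w τ x) (wt t x) t) →
      (∀ x, ContinuousOn (fun τ => wt τ x) (Set.Icc t₀ t₁)) →
      (∀ t ∈ Set.Icc t₀ t₁, ∀ x, wt t x + fderiv ℝ (w t) x (b t x) - (Δ (w t)) x = 0) →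
      (∀ t ∈ Set.Icc t₀ t₁, ∀ x, |w t x| ≤ M * (1 + ‖x‖)) →
      (∀ t, ContDiff ℝ 2 (Ψ t)) →
      ContinuousOn (Function.uncurry Ψ) (Set.Icc t₀ t₁ ×ˢ Set.univ) →
      (∀ x, ∀ t ∈ Set.Icc t₀ t₁, HasDerivAt (fun τ => Ψ τ x) (Ψt t x) t) →
      (∀ x, ContinuousOn (fun τ => Ψt τ x) (Set.Icc t₀ t₁)) →
      (∀ x, ContinuousOn (fun τ => fderiv ℝ (Ψ τ) x) (Set.Icc t₀ t₁)) →
      (∀ x, ContinuousOn (fun τ => (Δ (Ψ τ)) x) (Set.Icc t₀ t₁)) →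
      (∀ t ∈ Set.Icc t₀ t₁, ∀ x, (Δ (Ψ t)) x + A * ‖fderiv ℝ (Ψ t) x‖ ≤ Ψt t x) →
      (∀ t ∈ Set.Icc t₀ t₁, ∀ x, 0 ≤ Ψ t x) →
      (∀ x, |w t₀ x| ≤ Ψ t₀ x) →
      ∀ t ∈ Set.Icc t₀ t₁, ∀ x, |w t x| ≤ Ψ t x := by
  intro b A M w Ψ Ψt t₀ t₁ ht01 _ hbA wt hw_c hw2 _ _ hwt _ hlaw hgrowth hΨ2 hΨ_c hΨt _ _ _ hΨineq hΨ0 hinit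
    t ht x
  have h1 := sign_mul_le_of_superBarrier ht01 hbA hw_c hw2 hwt hlaw hgrowth hΨ2 hΨ_c hΨt hΨineq hΨ0 hinit
    (Or.inl rfl) t ht x
  have h2 := sign_mul_le_of_superBarrier ht01 hbA hw_c hw2 hwt hlaw hgrowth hΨ2 hΨ_c hΨt hΨineq hΨ0 hinit
    (Or.inr rfl) t ht x
  rw [one_mul] at h1
  rw [neg_one_mul] at h2
  exact abs_le.2 ⟨by linarith, h1⟩

end Summit.NavierStokesRegularity.NavierStokesRegularity.Theorems.PoloidalWindowDoorPoloidalWindowRigidityWholeSpaceComparison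

end
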